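import Summits.QuantumFields.YangMills.Theorems.CurvatureKernelBound.Negative.L1RPKernel
import Summits.QuantumFields.YangMills.Theorems.PencilRigidityCurvatureKernelBoundKernelPinning

/-!
# `CurvatureKernelBound` — negative lemmas, `ℓ¹` witness VI: reflection positivity of `T`

Supports crux item `stmt-QuantumFields-11687` (`PencilRigidity.CurvatureKernelBound`). Standing disprover's negative
lemmas (refuter, cdisprove cycle 3), ORDER-INSUFFICIENCY WITH REGULARITY chain `L1Kernel → L1Flat → L1Extension →
L1Package → L1RPKernel → L1RP → L1Main`, culminating in `L1Witness.not_axialGrowthOfTwoPointPackage`: the two-point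
shadow of `W₁ ∖ lattice` plus a representing kernel continuous off `0` do NOT imply the axial growth bound of Stub E
(`AxialGrowth`) of line `sixteen-charts-analytic-kernel`. No conclusion below asserts a Theses statement positively.

`rp_core`: for `g` vanishing outside `{x⁰ > 0}`, `∫ K(θu₀ − u₁) conj g(u₀) g(u₁) du = ∫_Ω w(λ) |∫ ψ_ω g|² dω`
(the joint integrand `Φ(u,ω)` is integrable on `(ℝ⁴)² × Ω` by `integrable_prod_iff`, its `ω`-integral is the kernel
integrand, its `u`-integral factorises over `Fin 2`, `∫ ψ conj g = conj ∫ ψ g`), hence the OS form is real and `≥ 0`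
(`rp_core_nonneg`); `T_reflectionPositive`: the E2 clause of the tree (`IsReflectionPositive`, degree-one components,
witness tensors `H i j` of `Θfᵢ* ⊗ fⱼ`) for `T`, by summing the family into `g = Σ fⱼ` and substituting
`x = (θu₀, u₁)`. Uses the lead's `isOffDiagonal_tensorFin_two`. [folklore]
-/

open scoped BigOperators Topology SchwartzMap
open MeasureTheory Filter Set Real
open Literature.MathematicalPhysics.QuantumLattice Literature.MathematicalPhysics.AQFT

noncomputable section

namespace Summit.QuantumFields.YangMills.Theorems.CurvatureKernelBound.Negative

namespace L1Witness

/-! ### Reflection positivity of `T`, II: the OS form is an integral of squares -/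

section RPCore

/-- Change of variables under a coordinatewise family of linear isometries. -/
theorem integral_comp_isometry₂ (R : Fin 2 → (E4 ≃ₗᵢ[ℝ] E4)) (G : (Fin 2 → E4) → ℂ) :
    ∫ x : Fin 2 → E4, G (fun i => R i (x i)) = ∫ x, G x := by
  have h : MeasurePreserving (fun (x : Fin 2 → E4) (i : Fin 2) => R i (x i)) :=
    volume_preserving_pi fun i => (R i).measurePreserving
  let e : (Fin 2 → E4) ≃ᵐ (Fin 2 → E4) :=
    MeasurableEquiv.piCongrRight fun i => (R i).toHomeomorph.toMeasurableEquiv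
  have he : (e : (Fin 2 → E4) → (Fin 2 → E4)) = fun x i => R i (x i) := rfl
  have h' : MeasurePreserving e := by rw [he]; exact h
  exact h'.integral_comp' G

/-- Auxiliary fact `integrable_comp_isometry₂` of the `ℓ¹`-witness construction (see the module docstring). [folklore] -/
theorem integrable_comp_isometry₂ (R : Fin 2 → (E4 ≃ₗᵢ[ℝ] E4)) {G : (Fin 2 → E4) → ℂ}
    (hG : Integrable G) : Integrable fun x : Fin 2 → E4 => G (fun i => R i (x i)) := by
  have h : MeasurePreserving (fun (x : Fin 2 → E4) (i : Fin 2) => R i (x i)) :=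
    volume_preserving_pi fun i => (R i).measurePreserving
  exact (h.integrable_comp hG.aestronglyMeasurable).2 hG

/-- The reflection acting on the first point only. -/
def Rθ : Fin 2 → (E4 ≃ₗᵢ[ℝ] E4) := ![timeReflection 4, LinearIsometryEquiv.refl ℝ E4]

/-- Auxiliary fact `Rθ_zero` of the `ℓ¹`-witness construction (see the module docstring). [folklore] -/
@[simp] theorem Rθ_zero (a : E4) : Rθ 0 a = timeReflection 4 a := rfl
/-- Auxiliary fact `Rθ_one` of the `ℓ¹`-witness construction (see the module docstring). [folklore] -/
@[simp] theorem Rθ_one (a : E4) : Rθ 1 a = a := rfl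

/-- The joint integrand `Φ(u, ω) = w(λ) (ψ_ω(u₀) conj g(u₀)) (ψ_ω(u₁) g(u₁))`. -/
def Φ (g : 𝓢(E4, ℂ)) (u : Fin 2 → E4) (ω : Ω) : ℂ :=
  (wt' ω.1 : ℂ) * (((psi ω (u 0) : ℂ) * (starRingEnd ℂ) (g (u 0))) * ((psi ω (u 1) : ℂ) * g (u 1)))

/-- Auxiliary fact `Φ_eq` of the `ℓ¹`-witness construction (see the module docstring). [folklore] -/
theorem Φ_eq (g : 𝓢(E4, ℂ)) (u : Fin 2 → E4) (ω : Ω) :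
    Φ g u ω = ((starRingEnd ℂ) (g (u 0)) * g (u 1)) *
      ((wt' ω.1 * (psi ω (u 0) * psi ω (u 1)) : ℝ) : ℂ) := by
  simp only [Φ]; push_cast; ring

/-- Auxiliary fact `norm_Φ` of the `ℓ¹`-witness construction (see the module docstring). [folklore] -/
theorem norm_Φ (g : 𝓢(E4, ℂ)) (u : Fin 2 → E4) (ω : Ω) :
    ‖Φ g u ω‖ = (wt' ω.1 * (psi ω (u 0) * psi ω (u 1))) * (‖g (u 0)‖ * ‖g (u 1)‖) := by
  rw [Φ_eq, norm_mul, Complex.norm_real, norm_mul, RCLike.norm_conj,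
    Real.norm_of_nonneg (mul_nonneg (wt'_nonneg _) (mul_nonneg (psi_nonneg _ _) (psi_nonneg _ _)))]
  ring

/-- Auxiliary fact `measurable_Φ_uncurry` of the `ℓ¹`-witness construction (see the module docstring). [folklore] -/
theorem measurable_Φ_uncurry (g : 𝓢(E4, ℂ)) :
    Measurable (Function.uncurry (Φ g)) := by
  unfold Φ Function.uncurry
  have hw : Measurable fun z : (Fin 2 → E4) × Ω => (wt' z.2.1 : ℂ) :=
    Complex.measurable_ofReal.comp (measurable_wt'.comp (measurable_fst.comp measurable_snd))
  have hpsi : ∀ i : Fin 2, Measurable fun z : (Fin 2 → E4) × Ω => (psi z.2 (z.1 i) : ℂ) := fun i =>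
    Complex.measurable_ofReal.comp (measurable_psi_uncurry.comp
      (measurable_snd.prodMk ((measurable_pi_apply i).comp measurable_fst)))
  have hg : ∀ i : Fin 2, Measurable fun z : (Fin 2 → E4) × Ω => g (z.1 i) := fun i =>
    g.continuous.measurable.comp ((measurable_pi_apply i).comp measurable_fst)
  exact hw.mul (((hpsi 0).mul ((Complex.continuous_conj.measurable).comp (hg 0))).mul
    ((hpsi 1).mul (hg 1)))

/-- The `ω`-integral of `Φ` recovers the kernel integrand. -/
theorem integral_Φ_ω (g : 𝓢(E4, ℂ)) (hg : ∀ u : E4, g u ≠ 0 → 0 < u 0) (u : Fin 2 → E4) :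
    ∫ ω, Φ g u ω =
      (Kw (timeReflection 4 (u 0) - u 1) : ℂ) * ((starRingEnd ℂ) (g (u 0)) * g (u 1)) := by
  by_cases h : g (u 0) = 0 ∨ g (u 1) = 0
  · have h0 : (starRingEnd ℂ) (g (u 0)) * g (u 1) = 0 := by
      rcases h with h | h <;> simp [h]
    simp_rw [Φ_eq, h0, zero_mul, integral_zero, mul_zero]
  · obtain ⟨h1, h2⟩ := not_or.1 h
    have ha : 0 < u 0 0 := hg _ h1
    have hb : 0 < u 1 0 := hg _ h2
    simp_rw [Φ_eq]
    rw [integral_const_mul, integral_complex_ofReal, integral_w_psi_psi ha hb]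
    ring

/-- Auxiliary fact `integrable_Φ_ω` of the `ℓ¹`-witness construction (see the module docstring). [folklore] -/
theorem integrable_Φ_ω (g : 𝓢(E4, ℂ)) (hg : ∀ u : E4, g u ≠ 0 → 0 < u 0) (u : Fin 2 → E4) :
    Integrable (Φ g u) := by
  by_cases h : g (u 0) = 0 ∨ g (u 1) = 0
  · have h0 : (starRingEnd ℂ) (g (u 0)) * g (u 1) = 0 := by
      rcases h with h | h <;> simp [h]
    have : Φ g u = fun _ => 0 := by funext ω; rw [Φ_eq, h0, zero_mul]
    rw [this]; exact integrable_zero _ _ _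
  · obtain ⟨h1, h2⟩ := not_or.1 h
    have ha : 0 < u 0 0 := hg _ h1
    have hb : 0 < u 1 0 := hg _ h2
    have : Φ g u = fun ω => ((starRingEnd ℂ) (g (u 0)) * g (u 1)) *
        ((wt' ω.1 * (psi ω (u 0) * psi ω (u 1)) : ℝ) : ℂ) := funext (Φ_eq g u)
    rw [this]
    exact ((integrable_w_psi_psi ha hb).ofReal).const_mul _

/-- Auxiliary fact `integral_norm_Φ_ω` of the `ℓ¹`-witness construction (see the module docstring). [folklore] -/
theorem integral_norm_Φ_ω (g : 𝓢(E4, ℂ)) (hg : ∀ u : E4, g u ≠ 0 → 0 < u 0) (u : Fin 2 → E4) :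
    ∫ ω, ‖Φ g u ω‖ = Kw (timeReflection 4 (u 0) - u 1) * (‖g (u 0)‖ * ‖g (u 1)‖) := by
  simp_rw [norm_Φ]
  rw [integral_mul_const]
  by_cases h : g (u 0) = 0 ∨ g (u 1) = 0
  · have h0 : ‖g (u 0)‖ * ‖g (u 1)‖ = 0 := by rcases h with h | h <;> simp [h]
    rw [h0, mul_zero, mul_zero]
  · obtain ⟨h1, h2⟩ := not_or.1 h
    rw [integral_w_psi_psi (hg _ h1) (hg _ h2)]

/-- The `u`-integral of `Φ` is `w(λ) |∫ ψ_ω g|²`. -/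
theorem integral_Φ_u (g : 𝓢(E4, ℂ)) (ω : Ω) :
    ∫ u : Fin 2 → E4, Φ g u ω =
      (((wt' ω.1 * ‖∫ a : E4, (psi ω a : ℂ) * g a‖ ^ 2 : ℝ)) : ℂ) := by
  set z : ℂ := ∫ a : E4, (psi ω a : ℂ) * g a with hz
  have hprod : ∀ u : Fin 2 → E4, Φ g u ω = (wt' ω.1 : ℂ) *
      ∏ i : Fin 2, (![fun a => (psi ω a : ℂ) * (starRingEnd ℂ) (g a), fun a => (psi ω a : ℂ) * g a] i) (u i) := by
    intro u
    rw [Fin.prod_univ_two]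
    rfl
  simp_rw [hprod]
  rw [integral_const_mul, integral_fintype_prod_volume_eq_prod, Fin.prod_univ_two]
  simp only [Matrix.cons_val_zero, Matrix.cons_val_one]
  have hconj : ∫ a : E4, (psi ω a : ℂ) * (starRingEnd ℂ) (g a) = (starRingEnd ℂ) z := by
    rw [hz, ← integral_conj]
    congr 1; funext a
    rw [map_mul, Complex.conj_ofReal]
  rw [hconj, ← hz, Complex.ofReal_mul]
  congr 1
  rw [← Complex.normSq_eq_norm_sq]
  exact Complex.normSq_eq_conj_mul_self.symm

/-- **The OS form of `T`'s kernel on a positive-time function is an integral of squares**: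
for `g` vanishing outside `{x⁰ > 0}`, `∫ K(θu₀ − u₁) conj g(u₀) g(u₁) du = ∫_Ω w |∫ ψ_ω g|² ≥ 0`. -/
theorem rp_core (g : 𝓢(E4, ℂ)) (hg : ∀ u : E4, g u ≠ 0 → 0 < u 0)
    (hint : Integrable fun u : Fin 2 → E4 =>
      (Kw (timeReflection 4 (u 0) - u 1) : ℂ) * ((starRingEnd ℂ) (g (u 0)) * g (u 1))) :
    ∫ u : Fin 2 → E4, (Kw (timeReflection 4 (u 0) - u 1) : ℂ) * ((starRingEnd ℂ) (g (u 0)) * g (u 1)) =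
      ((∫ ω : Ω, wt' ω.1 * ‖∫ a : E4, (psi ω a : ℂ) * g a‖ ^ 2 : ℝ) : ℂ) := by
  have hΦ : Integrable (Function.uncurry (Φ g)) (volume.prod volume) := by
    rw [integrable_prod_iff (measurable_Φ_uncurry g).aestronglyMeasurable]
    refine ⟨ae_of_all _ fun u => integrable_Φ_ω g hg u, ?_⟩
    have : (fun u : Fin 2 → E4 => ∫ ω, ‖Function.uncurry (Φ g) (u, ω)‖) =
        fun u => ‖(Kw (timeReflection 4 (u 0) - u 1) : ℂ) * ((starRingEnd ℂ) (g (u 0)) * g (u 1))‖ := by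
      funext u
      simp only [Function.uncurry_apply_pair]
      rw [integral_norm_Φ_ω g hg u, norm_mul, Complex.norm_real, Real.norm_of_nonneg (Kw_nonneg _),
        norm_mul, RCLike.norm_conj]
    rw [this]
    exact hint.norm
  calc ∫ u : Fin 2 → E4, (Kw (timeReflection 4 (u 0) - u 1) : ℂ) * ((starRingEnd ℂ) (g (u 0)) * g (u 1))
      = ∫ u : Fin 2 → E4, ∫ ω, Φ g u ω := by
        refine integral_congr_ae (ae_of_all _ fun u => ?_)
        exact (integral_Φ_ω g hg u).symm
    _ = ∫ ω, ∫ u : Fin 2 → E4, Φ g u ω := integral_integral_swap hΦ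
    _ = ∫ ω : Ω, (((wt' ω.1 * ‖∫ a : E4, (psi ω a : ℂ) * g a‖ ^ 2 : ℝ)) : ℂ) := by
        refine integral_congr_ae (ae_of_all _ fun ω => ?_)
        exact integral_Φ_u g ω
    _ = ((∫ ω : Ω, wt' ω.1 * ‖∫ a : E4, (psi ω a : ℂ) * g a‖ ^ 2 : ℝ) : ℂ) := integral_complex_ofReal

/-- Auxiliary fact `rp_core_nonneg` of the `ℓ¹`-witness construction (see the module docstring). [folklore] -/
theorem rp_core_nonneg (g : 𝓢(E4, ℂ)) (hg : ∀ u : E4, g u ≠ 0 → 0 < u 0)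
    (hint : Integrable fun u : Fin 2 → E4 =>
      (Kw (timeReflection 4 (u 0) - u 1) : ℂ) * ((starRingEnd ℂ) (g (u 0)) * g (u 1))) :
    let I := ∫ u : Fin 2 → E4, (Kw (timeReflection 4 (u 0) - u 1) : ℂ) * ((starRingEnd ℂ) (g (u 0)) * g (u 1))
    0 ≤ I.re ∧ I.im = 0 := by
  intro I
  have hI : I = ((∫ ω : Ω, wt' ω.1 * ‖∫ a : E4, (psi ω a : ℂ) * g a‖ ^ 2 : ℝ) : ℂ) :=
    rp_core g hg hint
  rw [hI, Complex.ofReal_re, Complex.ofReal_im]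
  exact ⟨integral_nonneg fun ω => mul_nonneg (wt'_nonneg _) (sq_nonneg _), rfl⟩

end RPCore


/-! ### Reflection positivity of `T`, III: the E2 clause on positive-time one-point families -/

section RPFamily

open Summit.QuantumFields.YangMills.Theorems.CurvatureKernel (isOffDiagonal_tensorFin_two)

/-- Auxiliary fact `pos_of_isPositiveTime` of the `ℓ¹`-witness construction (see the module docstring). [folklore] -/
theorem pos_of_isPositiveTime {f : 𝓢(E4, ℂ)} (hf : IsPositiveTime f) {u : E4} (hu : f u ≠ 0) :
    0 < u 0 :=
  hf (subset_tsupport _ hu)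

/-- Auxiliary fact `starTheta_apply` of the `ℓ¹`-witness construction (see the module docstring). [folklore] -/
@[simp] theorem starTheta_apply (f : 𝓢(E4, ℂ)) (x : E4) :
    starTest (thetaTest 4 f) x = (starRingEnd ℂ) (f (timeReflection 4 x)) := by
  simp

/-- `Θf*` is supported in the open negative half-space when `f` is positive-time. -/
theorem tsupport_starTheta_subset {f : 𝓢(E4, ℂ)} (hf : IsPositiveTime f) :
    tsupport ((starTest (thetaTest 4 f) : 𝓢(E4, ℂ)) : E4 → ℂ) ⊆ {x | x 0 < 0} := by
  have hfun : ((starTest (thetaTest 4 f) : 𝓢(E4, ℂ)) : E4 → ℂ) =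
      fun y : E4 => (starRingEnd ℂ) (f (timeReflection 4 y)) := by
    funext y; simp
  rw [hfun]
  have hcl : tsupport (fun y : E4 => (starRingEnd ℂ) (f (timeReflection 4 y))) ⊆
      (timeReflection 4) ⁻¹' tsupport (f : E4 → ℂ) := by
    refine closure_minimal (fun y hy => ?_) ((isClosed_tsupport _).preimage (timeReflection 4).continuous)
    have hy' : f (timeReflection 4 y) ≠ 0 := by
      intro h0; exact hy (by simp [h0])
    exact subset_tsupport _ hy'
  intro x hx
  have h0 : 0 < (timeReflection 4 x) 0 := hf (hcl hx)
  simp [timeReflection_apply] at h0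
  simpa using h0

/-- Auxiliary fact `isOffDiagonal_thetaTensor` of the `ℓ¹`-witness construction (see the module docstring). [folklore] -/
theorem isOffDiagonal_thetaTensor {f g : 𝓢(E4, ℂ)} (hf : IsPositiveTime f) (hg : IsPositiveTime g) :
    IsOffDiagonal (SchwartzMap.tensorFin 2 ![starTest (thetaTest 4 f), g]) := by
  refine isOffDiagonal_tensorFin_two (Set.disjoint_left.2 fun x hx hx' => ?_)
  have h1 : x 0 < 0 := tsupport_starTheta_subset hf hx
  have h2 : 0 < x 0 := hg hx'
  linarith

/-- **E2 for `T` (two-point shadow): the OS form on positive-time one-point families is `≥ 0`.** -/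
theorem T_reflectionPositive (N : ℕ) (f : Fin N → 𝓢(E4, ℂ)) (hf : ∀ j, IsPositiveTime (f j))
    (H : Fin N → Fin N → 𝓢((Fin 2 → E4), ℂ))
    (hH : ∀ i j, IsTensorOf (H i j) ![starTest (thetaTest 4 (f i)), f j]) :
    let z := ∑ i, ∑ j, T (H i j); 0 ≤ z.re ∧ z.im = 0 := by
  intro z
  have hEq : ∀ i j, H i j = SchwartzMap.tensorFin 2 ![starTest (thetaTest 4 (f i)), f j] :=
    fun i j => (hH i j).unique (isTensorOf_tensorFin _)
  have hoff : ∀ i j, IsOffDiagonal (H i j) := fun i j => by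
    rw [hEq i j]; exact isOffDiagonal_thetaTensor (hf i) (hf j)
  have happ : ∀ i j (x : Fin 2 → E4),
      H i j x = (starRingEnd ℂ) (f i (timeReflection 4 (x 0))) * f j (x 1) := by
    intro i j x
    rw [hH i j x, Fin.prod_univ_two]
    simp
  -- the summed positive-time function
  set g : 𝓢(E4, ℂ) := ∑ j, f j with hg
  have hgapp : ∀ u : E4, g u = ∑ j, f j u := fun u => by
    rw [hg]; simp
  have hgpos : ∀ u : E4, g u ≠ 0 → 0 < u 0 := by
    intro u hu
    rw [hgapp] at hu
    obtain ⟨j, -, hj⟩ := Finset.exists_ne_zero_of_sum_ne_zero hu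
    exact pos_of_isPositiveTime (hf j) hj
  -- the integrands
  set Fij : Fin N → Fin N → (Fin 2 → E4) → ℂ := fun i j x =>
    KC x * ((starRingEnd ℂ) (f i (timeReflection 4 (x 0))) * f j (x 1)) with hFij
  have hint_ij : ∀ i j, Integrable (Fij i j) := by
    intro i j
    refine (integrable_KC_mul (hoff i j)).congr (ae_of_all _ fun x => ?_)
    show KC x * H i j x = Fij i j x
    rw [happ]
  have hT : ∀ i j, T (H i j) = ∫ x, Fij i j x := by
    intro i j
    rw [T_eq_integral (hoff i j)]
    exact integral_congr_ae (ae_of_all _ fun x => by show KC x * H i j x = Fij i j x; rw [happ])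
  set Fg : (Fin 2 → E4) → ℂ := fun x =>
    KC x * ((starRingEnd ℂ) (g (timeReflection 4 (x 0))) * g (x 1)) with hFg
  have hFg_sum : ∀ x, Fg x = ∑ i, ∑ j, Fij i j x := by
    intro x
    simp only [hFg, hFij, hgapp, map_sum]
    rw [Finset.sum_mul_sum, Finset.mul_sum]
    refine Finset.sum_congr rfl fun i _ => ?_
    rw [Finset.mul_sum]
  have hint_g : Integrable Fg := by
    have : Fg = fun x => ∑ i, ∑ j, Fij i j x := funext hFg_sum
    rw [this]
    exact integrable_finsetSum _ fun i _ => integrable_finsetSum _ fun j _ => hint_ij i j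
  have hz : z = ∫ x, Fg x := by
    show ∑ i, ∑ j, T (H i j) = ∫ x, Fg x
    simp_rw [hT, hFg_sum]
    rw [integral_finsetSum _ fun i _ => integrable_finsetSum _ fun j _ => hint_ij i j]
    refine Finset.sum_congr rfl fun i _ => ?_
    rw [integral_finsetSum _ fun j _ => hint_ij i j]
  -- substitute x = (θ u₀, u₁)
  have hsub := integral_comp_isometry₂ Rθ Fg
  have hsimp : ∀ u : Fin 2 → E4, Fg (fun i => Rθ i (u i)) =
      (Kw (timeReflection 4 (u 0) - u 1) : ℂ) * ((starRingEnd ℂ) (g (u 0)) * g (u 1)) := by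
    intro u
    simp [hFg, KC_apply, timeReflection_timeReflection]
  have hint' : Integrable fun u : Fin 2 → E4 =>
      (Kw (timeReflection 4 (u 0) - u 1) : ℂ) * ((starRingEnd ℂ) (g (u 0)) * g (u 1)) := by
    have := integrable_comp_isometry₂ Rθ hint_g
    exact this.congr (ae_of_all _ fun u => hsimp u)
  have hfinal := rp_core_nonneg g hgpos hint'
  rw [hz, ← hsub]
  simp_rw [hsimp]
  exact hfinal

end RPFamily

end L1Witness

end Summit.QuantumFields.YangMills.Theorems.CurvatureKernelBound.Negative
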